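import Literature.MathematicalPhysics.QuantumFieldTheory.Balaban1983to89.B9PinMemberStarSupportSeparation

/-! # NODE 00 — Sect. E in the STAR convention, §1: variables `Λ`, constraint index `Λ′`, pivots `b₀(c)`, `Λ̃` (def-Y, STAR EDITION part 1)

[B9] p. 428: the form (3.156) «is considered on the subspace {B : B = 0 on Λᶜ, B = 0 on ⋃_{y∈Λ′} Ax(y), QB = 0}», parametrised by
«B̃ = B restricted to Λ̃ = Λ ∖ {⋃_{y∈Λ′} Ax(y) ∪ ⋃_{c∈Λ′} B(c) ∩ c}», and [4] (2.3) p. 224 ∕ Lemma 2.4 p. 245 fix the convention «Λ also the set of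
bonds b such that at least one of the end-points b₋, b₊ belongs to Λ» — the STAR convention, for BOTH the variables («B = 0 on Λᶜ») and the
constraint index («c ∈ Λ′»).  `Node00.OpsYSectEElim` (the record of 2026-08) reads the variables in the SOURCE convention
(`B9PinGeometryKLevelV1.inΛY`: base point in `Λ`) and the constraints on corners with BOTH end blocks good (`IsCoarseY`); that combination
leaves the `⟨good → non-good⟩` corners unconstrained, and at such members the block-constant pure gauges `∂^{(k)}λ` lie in the kernel of
`Δ_k(1)` on that subspace (dag-n08-b, CHECK-L 2026-08-29, kernel witness; `secCornerY (lamTY x) (CsDeltaCY … 1)` is then singular).  This file is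
§1 of the STAR EDITION that re-types the Sect. E subspace in print's convention, SIDE BY SIDE with the old decls (nothing is edited in place):

* `inΛstY x q` — «`q` a bond of `Λ`», star: top level and (source block good ∨ target block good); `inΛstY_iff` (the spelled-out shape the
  consumers `B1Eq324…Ineq2153ScalarReductionAtNode00` ∕ `…PrecisionDoorGamma0AtOne` quantify over), `inΛstY_of_goodY_usrc`;
* `IsCoarseStY x c` — «`c ∈ Λ′`», star: an `L`-corner with at least one good end block; `coarseStY`, `CBondStY`, `isCoarseStY_of_isCoarseY`,
  `coarseY_subset_coarseStY`;
* the pivot `b₀(c)` is `OpsYSectEElim.upivU` UNCHANGED (the last unit bond of the straight contour `c`): `upivU_src_shift` (its target is the corner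
  `c₊`), ★ `upivU_src_mem_Om_st` — its source lies in `Ω_k^{(k)}` for every star corner (when only `c₊` is good this is the separation `hΛsep`, through
  `B9PinMemberStarSupportSeparation.mem_Om_of_goodY_shift`), ★ `pivIStY` (the pivot as an index bond), `inΛstY_pivIStY` (a star pivot is a star
  variable), `IsPivStY`;
* `lamTstY` — «`Λ̃`», star: star variables that are neither axial (`IsAxialY`, unchanged) nor star pivots; `lamTstY_inΛst`.

§2–§4 (the pivot coefficients `K_c`, the letters `C`, `C*` re-indexed by `CBondStY`, the star sector `P_Λ^st` and the record instance) follow in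
the STAR EDITION's part 2.  HONEST MARGINS. (i) Nothing of [B9] ∕ [4] is asserted: definitions and bookkeeping over landed objects. (ii) The old
source-convention decls stay in the tree as they are; every theorem about them remains a correct implication (their doors are narrower than print's).
Net new unproved facts: 0.
-/

noncomputable section

namespace Literature.MathematicalPhysics.QuantumFieldTheory.Balaban1983to89.Node00

open B9PinMembersKLevelV1 (MemberY)
open B9PinGeometryKLevelV1 (inΛY)
open B6GlobalChartV1 (PV domT)
open B6Ineq2142KLevelV1 (lvl baseSite)

variable {d ℓ : ℕ} {hd : 1 ≤ d + 1} {hL : Odd (ℓ + 1) ∧ 1 < ℓ + 1} {b₀ b₁ : ℝ} {Mstar : ℕ}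
variable (x : MemberY d ℓ hd hL b₀ b₁ Mstar)

/-- **«B on Λ», STAR CONVENTION**: a top-level index bond with its source block OR its target block good
(print: bonds with at least one end-point in `Λ`). [cite: Balaban1984PropagatorsII, (2.3) p.224; Balaban1985BackgroundPropagators, p.428] -/
def inΛstY (q : IBondY x.toKIdx) : Prop := lvl x.hN x.D x.hk q = x.k ∧ (GoodY x (usrc x q) ∨ GoodY x (utgt x q))

/-- the star variable predicate, spelled out (the shape quantified over by the (2.153)-row consumers). [cite: Balaban1985BackgroundPropagators, p.428, bookkeeping] -/
theorem inΛstY_iff (q : IBondY x.toKIdx) :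
    inΛstY x q ↔ lvl x.hN x.D x.hk q = x.k ∧ (GoodY x (usrc x q) ∨ GoodY x (utgt x q)) := Iff.rfl

/-- a top-level bond with a good source block is a star variable. [cite: Balaban1985BackgroundPropagators, p.428, bookkeeping] -/
theorem inΛstY_of_goodY_usrc {q : IBondY x.toKIdx} (hq : lvl x.hN x.D x.hk q = x.k) (hg : GoodY x (usrc x q)) : inΛstY x q := ⟨hq, Or.inl hg⟩

/-- a top-level bond with a good target block is a star variable. [cite: Balaban1985BackgroundPropagators, p.428, bookkeeping] -/
theorem inΛstY_of_goodY_utgt {q : IBondY x.toKIdx} (hq : lvl x.hN x.D x.hk q = x.k) (hg : GoodY x (utgt x q)) : inΛstY x q := ⟨hq, Or.inr hg⟩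

/-- a star variable has its source in `Ω_k^{(k)}` (so the source-based readings `readUY ∕ idxOfU` see it). [cite: Balaban1984PropagatorsII, (2.2)–(2.3) p.224] -/
theorem usrc_mem_Om_of_inΛstY {q : IBondY x.toKIdx} (h : inΛstY x q) : usrc x q ∈ (domT x.hN x.D x.hk).Om x.k :=
  B9PinMemberStarSupportSeparation.usrc_mem_Om_of_star x q h.1 h.2

/-- **«c ∈ Λ′», STAR CONVENTION**: an `L`-corner with at least one good end block. [cite: Balaban1985BackgroundPropagators, (3.157) p.428; Balaban1984PropagatorsII, Lemma 2.4 p.245] -/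
def IsCoarseStY (c : USiteY x × Fin (d + 1)) : Prop := IsCornerY x c.1 ∧ (GoodY x c.1 ∨ GoodY x (unextY x c.1 c.2))

/-- both-good corners are star corners. [cite: Balaban1985BackgroundPropagators, (3.157) p.428, bookkeeping] -/
theorem isCoarseStY_of_isCoarseY {c : USiteY x × Fin (d + 1)} (h : IsCoarseY x c) : IsCoarseStY x c := ⟨h.1, Or.inl h.2.1⟩

open Classical in
/-- the finite set of star corners. [cite: Balaban1985BackgroundPropagators, (3.157) p.428, dictionary] -/
def coarseStY : Finset (USiteY x × Fin (d + 1)) := Finset.univ.filter fun c => IsCoarseStY x c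

/-- membership. [cite: Balaban1985BackgroundPropagators, (3.157) p.428, bookkeeping] -/
theorem mem_coarseStY {c : USiteY x × Fin (d + 1)} : c ∈ coarseStY x ↔ IsCoarseStY x c := by
  classical
  simp [coarseStY]

/-- the old (both-good) index set is contained in the star one. [cite: Balaban1985BackgroundPropagators, (3.157) p.428, bookkeeping] -/
theorem coarseY_subset_coarseStY : coarseY x ⊆ coarseStY x := fun _ hc =>
  (mem_coarseStY x).2 (isCoarseStY_of_isCoarseY x ((mem_coarseY x).1 hc))

/-- the type of star corners. [cite: Balaban1985BackgroundPropagators, (3.157) p.428, dictionary] -/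
abbrev CBondStY : Type := ↥(coarseStY x)

/-- a star corner satisfies the predicate. [cite: Balaban1985BackgroundPropagators, (3.157) p.428, bookkeeping] -/
theorem isCoarseStY_of (c : CBondStY x) : IsCoarseStY x c.1 := (mem_coarseStY x).1 c.2

/-- the old (both-good) coarse bonds as star corners. [cite: Balaban1985BackgroundPropagators, (3.157) p.428, bookkeeping] -/
def CBondY.toSt (c : CBondY x) : CBondStY x := ⟨c.1, coarseY_subset_coarseStY x c.2⟩

/-- the inclusion of the old coarse bonds preserves the underlying (corner, direction). [cite: Balaban1985BackgroundPropagators, (3.157) p.428, bookkeeping] -/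
@[simp] theorem CBondY.toSt_val (c : CBondY x) : (CBondY.toSt x c).1 = c.1 := rfl

/-- the pivot's target is the next corner `c₊`. [cite: Balaban1985BackgroundPropagators, p.428 («b₊ ∈ B(c₊)»), bookkeeping] -/
theorem upivU_src_shift (c : USiteY x × Fin (d + 1)) : ((upivU x c).src).shift c.2 = unextY x c.1 c.2 := by
  show (ofZ x (labK x c.1 + (ℓ : ℤ) • B6BondElimination.unitVec c.2)).shift c.2 = ofZ x (labK x c.1 + (((ℓ + 1 : ℕ) : ℤ)) • B6BondElimination.unitVec c.2)
  rw [← ofZ_add_unitVec, add_assoc, ← add_one_zsmul]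
  rfl

/-- **THE STAR PIVOT'S SOURCE LIES IN `Ω_k^{(k)}`** (for a corner with at least one good end: if only `c₊` is good, by the separation
`MemberY.hΛsep` via `B9PinMemberStarSupportSeparation.mem_Om_of_goodY_shift`). [cite: Balaban1984PropagatorsII, (2.2)–(2.3) p.224] -/
theorem upivU_src_mem_Om_st {c : USiteY x × Fin (d + 1)} (hc : IsCoarseStY x c) : (upivU x c).src ∈ (domT x.hN x.D x.hk).Om x.k :=
  hc.2.elim (fun hg => mem_Om_of_mem_ublockY x hg (upivU_src_mem_ublockY x hc.1))
    (fun hg => B9PinMemberStarSupportSeparation.mem_Om_of_goodY_shift x _ c.2 (by rwa [upivU_src_shift]))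

/-- ★ **THE STAR PIVOT INDEX BOND `b₀(c)`**, `c` a star corner. [cite: Balaban1985BackgroundPropagators, p.428 («the bonds b₀»)] -/
def pivIStY (c : CBondStY x) : IBondY x.toKIdx := idxOfU x (upivU x c.1) (upivU_src_mem_Om_st x ((mem_coarseStY x).1 c.2))

/-- on the old coarse bonds the star pivot IS the old pivot `pivIY`. [cite: Balaban1985BackgroundPropagators, p.428, bookkeeping] -/
@[simp] theorem pivIStY_toSt (c : CBondY x) : pivIStY x (CBondY.toSt x c) = pivIY x c := rfl

/-- ★ **A STAR PIVOT IS A STAR VARIABLE** (its target block `B(c₊)` or its source block `B(c₋)` is good). [cite: Balaban1985BackgroundPropagators, p.428 («Λ̃ = Λ ∖ {… ⋃ B(c) ∩ c}»), bookkeeping] -/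
theorem inΛstY_pivIStY (c : CBondStY x) : inΛstY x (pivIStY x c) := by
  have hc : IsCoarseStY x c.1 := (mem_coarseStY x).1 c.2
  refine ⟨rfl, ?_⟩
  rw [pivIStY, usrc_idxOfU, utgt_idxOfU]
  rcases hc.2 with hg | hg
  · exact Or.inl (goodY_of_mem_ublockY x hg (upivU_src_mem_ublockY x hc.1))
  · refine Or.inr ?_
    have e : (upivU x c.1).tgt = ((upivU x c.1).src).shift c.1.2 := rfl
    rw [e, upivU_src_shift]
    exact hg

/-- a bond is a star pivot `b₀(c)`, `c ∈ Λ′`. [cite: Balaban1985BackgroundPropagators, p.428, dictionary] -/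
def IsPivStY (q : IBondY x.toKIdx) : Prop := ∃ c : CBondStY x, pivIStY x c = q

/-- **`Λ̃`, STAR CONVENTION**: star variables that are neither axial nor star pivots. [cite: Balaban1985BackgroundPropagators, p.428 («Λ̃ = Λ ∖ {…}»)] -/
def lamTstY (q : IBondY x.toKIdx) : Prop := inΛstY x q ∧ ¬ IsAxialY x q ∧ ¬ IsPivStY x q

/-- `Λ̃ ⊂ Λ` (star). [cite: Balaban1985BackgroundPropagators, p.428, bookkeeping] -/
theorem lamTstY_inΛst {q : IBondY x.toKIdx} (h : lamTstY x q) : inΛstY x q := h.1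

end Literature.MathematicalPhysics.QuantumFieldTheory.Balaban1983to89.Node00
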